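import Summits.SmoothPoincare4.SmoothPoincare4.Theses.CircularKirby
import Literature.Topology.FourManifolds.SphereSimplyConnected

/-!
# Birth skeleton for crux `CircularKirby.WidthFour` (stmt-SmoothPoincare4-6425)

planner-skel-stmt-SmoothPoincare4-6425-0 · skeleton-register (BC3, one-shot) · 2026-08-17.
Route `route-SmoothPoincare4-CircularKirby` (rev 5), crux #4 (rank 4, OPEN / open-problem):
every closed smooth `X ≃ₕ S¹×S³` containing a smoothly embedded non-separating `S³` (the class
`𝒳`) admits a PRIMITIVE circle-valued Morse function (connected pullback of `Circle.exp`) with at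
most `4` critical points — `μ○(X) ≤ 4`.

## The line — DE-SUM, COMPRESS ON THE INTERVAL, CLOSE UP THE INTERVAL (the route's own foreseen split)

The route header (TWO-LAYER PLAN) foresees `WidthFour ⇐ TwoTwoHandles → HandlesToCircular`;
this file types that split honestly, making the passage `X ↦ Σ` explicit:

* S1 `stub_desum` (`Desum`, a THEOREM on paper, XL in Lean): every `X ∈ 𝒳` is a connected sum
  `M # (S¹×S³)` (tree notion `IsConnectedSum`) of some Hausdorff second-countable smooth
  4-manifold `M ≃ₕ S⁴` with `S¹×S³`. Proof on paper: `X` is orientable (orientability of closed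
  manifolds is a homotopy invariant), so the non-separating `A ≅ S³` is two-sided; cut `X` along
  `A` to get a compact connected `W` with `∂W = S³ ⊔ S³`; `π₁X = π₁W ∗ ℤ` (HNN over `π₁A = 1`) and
  `π₁X = ℤ` give `π₁W = 1` (Grushko); `χ(W) = χ(X) = 0`; cap both spheres with 4-balls:
  `Σ := W ∪ 2D⁴` is closed, simply connected, `χ = 2`, hence `H₂ = 0` and `Σ ≃ₕ S⁴`
  (Hurewicz–Whitehead); and `X = (Σ ∖ 2B̊⁴) ∪ (S³ × I) = Σ # (S¹×S³)` (self-sum = sum with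
  `S¹×S³`, orientation-consistently since `X` is orientable). It is the converse of the route's
  support item `Platform`.
* S2 `stub_morseSix` (`MorseNumberSix`, OPEN — the load-bearing stub): every Hausdorff
  second-countable compact smooth `M ≃ₕ S⁴` admits a Morse function `M → ℝ` with at most SIX
  critical points, `μ(Σ) ≤ 6`. By 0/1- and 3/4-cancellation on a connected manifold (Milnor 1965
  Thm 8.1) and the Morse equality `χ(Σ) = 2 = 1 − c₁ + c₂ − c₃ + 1`, this is EXACTLY "`Σ` has a
  handle decomposition with one 0-handle, one 4-handle and at most two 2-handles" — the
  `TwoTwoHandles` of the route header, stated index-free over the tree's `IsMorse`/`criticalSet`.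
  Patterns `(c₁,c₂,c₃) ∈ {(0,0,0),(1,1,0),(0,1,1)}` are standard spheres (Property R, Gabai 1987);
  the content is `(0,2,2), (1,2,1), (2,2,0)` — the Akbulut–Kirby/Cappell–Shaneson presentations
  live in `(2,2,0)`. It is NOT the crux (interval-valued, no rotation: `μ○ ≤ μ − 2` is the only
  link) and NOT the summit (it leaves the recognition of `≤ 2`-two-handle homotopy spheres, i.e.
  the route's `RankTwo` sectors, untouched).
* S3 `stub_stabilise` (`CircularStabilisation`, a THEOREM on paper, XL in Lean; no homotopy-sphere
  hypothesis): for every closed connected smooth 4-manifold `M`, every Morse `f : M → ℝ` with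
  finite critical set and every connected sum `X = M # (S¹×S³)`:
  `μ○(X) ≤ #Crit(f) − 2`, realised by a primitive circle-valued Morse function. Proof on paper:
  cancel extra minima/maxima (Milnor 1965 Thm 8.1, `M` connected) so `f` has one minimum `p₀` and
  one maximum `p₄`; by the Morse lemma small sub/super-level sets at `p₀`, `p₄` are 4-balls with
  level-sphere boundaries; on `M°° = M ∖ (B̊₀ ∪ B̊₄)` the function `f` is a collar coordinate at
  both ends; identify the ends by a gradient-collar-compatible diffeomorphism `∂B₄ → ∂B₀`
  (orientation chosen so that the result is `M # (S¹×S³)`, not the twisted sum): `f` descends to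
  `θ = exp(2πi·(f − a)/(b − a)) : X' → S¹`, smooth, Morse, with `Crit θ = Crit f ∖ {p₀, p₄}`;
  its `exp`-pullback cover is the bi-infinite chain of copies of `M°°` (connected: removing two
  balls from a connected 4-manifold keeps it connected), so `θ` is primitive; finally
  `X' ≅ M # (S¹×S³) ≅ X` for ANY `IsConnectedSum` structure (disc theorem of Palais–Cerf;
  `S¹×S³` is connected and admits orientation-reversing diffeomorphisms; Kervaire–Milnor Lemma
  2.1 / Kosinski VI.1), and circle-valued Morse functions, their critical sets and the
  connectedness of the pullback cover transport along diffeomorphisms.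

Composition `WidthFour_of : S1 → S2 → S3 → WidthFour` is kernel-checked (hypotheses spelled
through the name-keyed aliases `__Registered.stub_*`, definitionally S1–S3): from `X ∈ 𝒳`, S1
gives `(M, eM : M ≃ₕ S⁴)` with `X = M # (S¹×S³)`; the proof DERIVES `CompactSpace M`
(`compactSpace_of_homotopyEquiv_sphere_four_holds`, Hatcher 3.29) and `ConnectedSpace M`
(`simplyConnectedSpace_sphere_four_holds` + `HomotopyEquiv.simplyConnectedSpace`); S2 gives a
Morse `f` with `#Crit f ≤ 6` (hence finite, `Set.finite_of_encard_le_coe`); S3 gives a primitive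
circle-valued Morse `g` on `X` with `#Crit g + 2 ≤ #Crit f ≤ 6`, and `ℕ∞`-cancellation
(`ENat.add_le_add_iff_right`) yields `#Crit g ≤ 4` — verbatim the crux's matrix
(`isPrimitiveCircleMorse_iff`, `Iff.rfl`).

Disproof.lean: none exists for this crux (`ledger crux ls stmt-SmoothPoincare4-6425`: no
workfiles, 2026-08-17) — no `_false_without_<H>` obligation to honour. Negatives index
(`ledger negatives --problem SmoothPoincare4`): 0 refuted statements; no landed
`Theorems/*/Negative/*` lemma of the sub concerns Morse numbers, connected sums with `S¹×S³` or
circle-valued functions, so no stub is an instance of one. Barriers (route header):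
PropertyTwoR / StrictPropertyTwoR (AC-shadow of handle-SLIDE proofs over the level `S³`) — S2
asserts the EXISTENCE of a small handle structure and slides nothing, S1/S3 are constructions;
LowGenusTrisection / CappellShaneson — the `(2,2,0)` presentations are test inputs of S2, not
claimed standard here; TwistedSphere / HCobordism — recognition-side (RankTwo, FibredIsStandard),
not this ∃-half. Honest dependence: an exotic `S⁴` all of whose Morse functions need `≥ 8`
critical points (`≥ 3` two-handles) refutes S2 — and then this LINE, not necessarily the crux
(rotation may still reach `μ○ ≤ 4`; that freedom is deliberately unused by `birth`).
Cheapest falsifier of S2: none cheap (it is implied by SPC4); of S3: the degenerate instance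
`M = S⁴`, `f` = height (2 critical points) must give a SUBMERSION `S¹×S³ → S¹` with connected
pullback cover — it does (the projection).
-/

noncomputable section

set_option linter.dupNamespace false

namespace Summit.SmoothPoincare4.SmoothPoincare4.Cruxes.WidthFour.Birth

open scoped Manifold ContDiff Topology ContinuousMap
open Literature.Topology.FourManifolds (IsMorse criticalSet mhessian IsConnectedSum)
open Summit.SmoothPoincare4.SmoothPoincare4.Theses.CircularKirby (WidthFour)

/-- Local notation: the model space `ℝ⁴`. -/
local notation "ℝ⁴" => EuclideanSpace ℝ (Fin 4)
/-- Local notation: the standard `3`-sphere `S³ ⊂ ℝ⁴`. -/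
local notation "𝕊³" => (Metric.sphere (0 : EuclideanSpace ℝ (Fin 4)) 1)
/-- Local notation: the standard `4`-sphere `S⁴ ⊂ ℝ⁵`. -/
local notation "𝕊⁴" => (Metric.sphere (0 : EuclideanSpace ℝ (Fin 5)) 1)

/-! ## Vocabulary (definitional abbreviations of the crux's own clauses) -/

section Vocabulary

variable {X : Type*} [TopologicalSpace X] [ChartedSpace ℝ⁴ X]

/-- **Primitive circle-valued Morse function** on a smooth 4-manifold — verbatim the first three
clauses of the crux's conclusion: `g : X → S¹` is `C^∞`; the pullback of the universal cover
`Circle.exp : ℝ → S¹` along `g` is connected (the class `g^*[dθ]` is primitive and `X` is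
connected); and at every critical point the local height `y ↦ Im (g y / g x)` has nondegenerate
Hessian (tree `mhessian`). -/
def IsPrimitiveCircleMorse (g : X → Circle) : Prop :=
  ContMDiff (𝓡 4) (𝓡 1) ∞ g ∧ IsConnected {p : X × ℝ | g p.1 = Circle.exp p.2} ∧
    ∀ x, mfderiv (𝓡 4) (𝓡 1) g x = 0 →
      (mhessian (𝓡 4) (fun y => ((g y / g x : Circle) : ℂ).im) x).Nondegenerate

/-- The critical set of a circle-valued function — verbatim the set the crux counts. -/
def circleCriticalSet (g : X → Circle) : Set X :=
  {x | mfderiv (𝓡 4) (𝓡 1) g x = 0}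

/-- The vocabulary is DEFINITIONALLY the crux's matrix. -/
theorem isPrimitiveCircleMorse_iff (g : X → Circle) :
    IsPrimitiveCircleMorse g ↔
      ContMDiff (𝓡 4) (𝓡 1) ∞ g ∧ IsConnected {p : X × ℝ | g p.1 = Circle.exp p.2} ∧
        ∀ x, mfderiv (𝓡 4) (𝓡 1) g x = 0 →
          (mhessian (𝓡 4) (fun y => ((g y / g x : Circle) : ℂ).im) x).Nondegenerate :=
  Iff.rfl

/-- Unfolding lemma for `circleCriticalSet`. -/
theorem mem_circleCriticalSet_iff (g : X → Circle) (x : X) :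
    x ∈ circleCriticalSet g ↔ mfderiv (𝓡 4) (𝓡 1) g x = 0 :=
  Iff.rfl

end Vocabulary

/-! ## The stub statements -/

/-- **S1 — DE-SUM: a member of `𝒳` is `Σ # (S¹×S³)` for a homotopy 4-sphere `Σ`.** For every
closed smooth 4-manifold `X ≃ₕ S¹×S³` containing a smoothly embedded `S³` with connected
complement there is a Hausdorff second-countable smooth 4-manifold `M ≃ₕ S⁴` such that `X` is a
connected sum of `M` with `S¹×S³` (tree `IsConnectedSum`, models `𝓡 4`, `𝓡 4`, `𝓡 1 × 𝓡 3`, the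
argument order of the route's `Platform`/`Remembers`). Cut along the sphere, cap with two balls
(`W ∪ 2D⁴`), and read `X = (Σ ∖ 2B̊⁴) ∪ S³×I` as the self-sum. Compactness of `M` is not asserted
(it follows from `M ≃ₕ S⁴`, Hatcher 3.29, tree theorem). -/
def Desum : Prop :=
  ∀ (X : Type) [TopologicalSpace X] [T2Space X] [SecondCountableTopology X] [CompactSpace X]
    [ChartedSpace ℝ⁴ X] [IsManifold (𝓡 4) ∞ X],
    X ≃ₕ (Circle × 𝕊³) →
    (∃ e : 𝕊³ → X, Manifold.IsSmoothEmbedding (𝓡 3) (𝓡 4) ∞ e ∧ IsConnected (Set.range e)ᶜ) →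
    ∃ (M : Type) (_ : TopologicalSpace M) (_ : T2Space M) (_ : SecondCountableTopology M)
      (_ : ChartedSpace ℝ⁴ M) (_ : IsManifold (𝓡 4) ∞ M),
      Nonempty (M ≃ₕ 𝕊⁴) ∧ IsConnectedSum (𝓡 4) (𝓡 4) ((𝓡 1).prod (𝓡 3)) M (Circle × 𝕊³) X

/-- **S2 — MORSE NUMBER SIX (`TwoTwoHandles`, OPEN).** Every Hausdorff second-countable compact
smooth 4-manifold homotopy equivalent to `S⁴` admits a Morse function with at most six critical
points. Equivalent (0/1- and 3/4-cancellation, Milnor 1965 Thm 8.1; Morse equality with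
`χ = 2`) to a handle decomposition with one 0-handle, one 4-handle and at most two 2-handles. -/
def MorseNumberSix : Prop :=
  ∀ (M : Type) [TopologicalSpace M] [T2Space M] [SecondCountableTopology M] [CompactSpace M]
    [ChartedSpace ℝ⁴ M] [IsManifold (𝓡 4) ∞ M],
    M ≃ₕ 𝕊⁴ → ∃ f : M → ℝ, IsMorse (𝓡 4) f ∧ (criticalSet (𝓡 4) f).encard ≤ 6

/-- **S3 — CIRCULAR STABILISATION: `μ○(M # (S¹×S³)) ≤ μ(M) − 2`.** For every closed connected
smooth 4-manifold `M`, every Morse function `f : M → ℝ` with finite critical set, and every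
smooth 4-manifold `X` that is a connected sum of `M` with `S¹×S³`, there is a primitive
circle-valued Morse function on `X` with at most `#Crit(f) − 2` critical points (remove the
minimum and maximum balls, identify the level spheres, let `f` wrap once around the circle). -/
def CircularStabilisation : Prop :=
  ∀ (M : Type) [TopologicalSpace M] [T2Space M] [SecondCountableTopology M] [CompactSpace M]
    [ConnectedSpace M] [ChartedSpace ℝ⁴ M] [IsManifold (𝓡 4) ∞ M] (f : M → ℝ),
    IsMorse (𝓡 4) f → (criticalSet (𝓡 4) f).Finite →
    ∀ (X : Type) [TopologicalSpace X] [T2Space X] [SecondCountableTopology X] [CompactSpace X]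
      [ChartedSpace ℝ⁴ X] [IsManifold (𝓡 4) ∞ X],
      IsConnectedSum (𝓡 4) (𝓡 4) ((𝓡 1).prod (𝓡 3)) M (Circle × 𝕊³) X →
      ∃ g : X → Circle, IsPrimitiveCircleMorse g ∧
        (circleCriticalSet g).encard + 2 ≤ (criticalSet (𝓡 4) f).encard

/-! ## The stubs S1–S3 (the only `sorry`s of the file) -/

/-- **S1 `stub_desum`** — THEOREM on paper (folklore; the converse of the route's `Platform`),
size L on paper / XL in Lean (cutting along a two-sided hypersurface, capping, connected-sum
bookkeeping are not in Mathlib). Statement: `Desum`. WHY TRUE: see the file header —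
orientability of `X` (homotopy invariance of `w₁` for closed manifolds) makes `A` two-sided;
`π₁(X) = π₁(W) ∗ ℤ = ℤ` forces `π₁(W) = 1` (Grushko); `χ(W) = 0`, so `Σ = W ∪ 2D⁴` is a simply
connected closed 4-manifold with `χ = 2`, i.e. `H₂ = 0`, i.e. `Σ ≃ₕ S⁴` (Hurewicz + Whitehead;
tree `HomotopySphereRecognition`); `X = Σ°° ∪ S³×I = Σ # (S¹×S³)`. WHY IT MIGHT FAIL (in Lean
only): the tree's `IsConnectedSum` is relational — the proof must exhibit disc embeddings and an
open gluing; the needed existence/uniqueness theorems for gluings are XL. Leans on: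
`Literature.Topology.FourManifolds.IsConnectedSum`, `IsOpenGluing`, `exists_isConnectedSum`
(proved), `HomotopySphereRecognition`, Mathlib `Manifold.IsSmoothEmbedding`.
[BudneyGabai2019 §3 (arXiv:1912.09029); KervaireMilnor1963 §2; Kosinski1993 VI.1–3;
HatcherAT2002 Prop. 3.29, Thm. 4.32.] -/
theorem stub_desum : Desum := by
  sorry

/-- **S2 `stub_morseSix`** — OPEN; the load-bearing stub of this line (hardest). Statement:
`MorseNumberSix`. WHY IT MIGHT HOLD: every KNOWN homotopy 4-sphere presentation has `≤ 2`
two-handles after simplification (Cappell–Shaneson / Akbulut–Kirby: two 1-handles, two 2-handles,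
no 3-handles; Gluck twists of ribbon 2-knots), and no invariant is known that bounds the
2-handle number of a homotopy 4-sphere from below; it is trivially implied by SPC4 (`S⁴` has
`μ = 2`). WHY IT MIGHT FAIL (= the crux's own note): no compression technique reduces the
2-handle count of an UNKNOWN `Σ` (1↔3 trading needs embedded discs, Kirby 4.18); an exotic `S⁴`
whose every handle structure needs `≥ 3` two-handles (e.g. a Gluck twist of a non-ribbon 2-knot)
refutes it. Independent of the summit's truth value it is a statement about the MORSE NUMBER of
homotopy 4-spheres, strictly on the interval-valued side of the crux (`μ○ ≤ μ − 2`, S3). Size: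
OPEN. Leans on: `Literature.Topology.FourManifolds.IsMorse`, `criticalSet`.
[Kirby1997 Problems 4.18, 4.89; GompfStipsicz1999 §5.1; AkbulutKirby1985; Gompf1991Killing;
Milnor1965 Thm 8.1; MeierZupan2017 (genus ≤ 2 trisections standard).] -/
theorem stub_morseSix : MorseNumberSix := by
  sorry

/-- **S3 `stub_stabilise`** — THEOREM on paper (the inequality `μ○(M # S¹×S³) ≤ μ(M) − 2`
behind the crux's docstring "a decomposition with (k, n, n−k) 1-,2-,3-handles gives a circular
function on `X_Σ` with `2n` critical points"), size L on paper / XL in Lean. Statement: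
`CircularStabilisation`. WHY TRUE: see the file header — (a) cancel extra extrema against
1- and 3-handles (`M` connected; Milnor 1965 Thm 8.1 and its dual), (b) Morse lemma at the unique
minimum/maximum: ball neighbourhoods with level-sphere boundaries, (c) identify the two level
spheres compatibly with the gradient collars so that `f` descends to a circle-valued Morse `θ`
on the closed-up manifold `X'` with `Crit θ = Crit f ∖ {min, max}`, (d) the `exp`-pullback cover
of `θ` is `⋯ ∪ M°° ∪ M°° ∪ ⋯`, connected, (e) `X' ≅ M # (S¹×S³) ≅ X` for any `IsConnectedSum`
structure (disc theorem; `S¹×S³` admits orientation-reversing diffeomorphisms; Kervaire–Milnor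
Lemma 2.1, Kosinski VI.1.1) and everything transports along the diffeomorphism (critical sets
biject; nondegeneracy of `mhessian` at a critical point is chart-independent). WHY IT MIGHT FAIL
(in Lean only): steps (c) and (e) need gluing/collar infrastructure (partly in tree:
`CollarGluing`, `ConnectedSumTransportProofs`) and the chart-independence of `mhessian`
nondegeneracy (tree fact `mhessian`-congruence, unproved). CHEAPEST FALSIFIER / degenerate
instance: `M = S⁴`, `f` = a height function (2 critical points), `X = S¹×S³` with the standard
sum structure: the conclusion asks for a primitive circle-valued Morse function with NO critical
points — the projection `S¹×S³ → S¹` is one. Leans on: `Literature.Topology.FourManifolds.IsMorse`,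
`criticalSet`, `mhessian`, `IsConnectedSum`, `IsOpenGluing`, Mathlib `Circle.exp`, `mfderiv`.
[Pajitnov2006 Ch. 2–3; EndoPajitnov2017 §1 (arXiv:1502.06352, `MN ≤ μ − 2`-type bounds);
Milnor1963 Lemma 2.2; Milnor1965 Thm 8.1; KervaireMilnor1963 Lemma 2.1; Kosinski1993 VI.1.] -/
theorem stub_stabilise : CircularStabilisation := by
  sorry

/-! ## Name-keyed aliases of the three statements — the hypotheses of `WidthFour_of`

The native skeleton audit (`#h21_check_skeleton`, run by `ledger skeleton check`) admits a
hypothesis of the composing theorem only if its head constant is a registered obligation or is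
NAMED like a declared stub; `__Registered.stub_X` is statement `X` under the registered stub's
short name (device of `Cruxes/MultiplicityFour/Lines/birth.lean`). Each alias is an `abbrev`,
definitionally its statement. -/
namespace __Registered

/-- Alias of `Desum` keyed by the registered stub name. -/
abbrev stub_desum : Prop := Desum
/-- Alias of `MorseNumberSix` keyed by the registered stub name. -/
abbrev stub_morseSix : Prop := MorseNumberSix
/-- Alias of `CircularStabilisation` keyed by the registered stub name. -/
abbrev stub_stabilise : Prop := CircularStabilisation

end __Registered

/-! ## Proved: the composition -/

/-- **`WidthFour` from the three stub statements.** Given `X ∈ 𝒳` (the crux's binders): S1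
de-sums `X = M # (S¹×S³)` with `eM : M ≃ₕ S⁴`; `M` is compact (Hatcher 3.29, proved fact) and
simply connected hence connected (`π₁(S⁴) = 1`, proved fact, transported along `eM`); S2 gives a
Morse `f` on `M` with `#Crit f ≤ 6`, in particular finite; S3 gives a primitive circle-valued
Morse `g` on `X` with `#Crit g + 2 ≤ #Crit f`; cancelling `2` in `ℕ∞` gives `#Crit g ≤ 4`. -/
theorem WidthFour_of :
    __Registered.stub_desum → __Registered.stub_morseSix → __Registered.stub_stabilise →
      WidthFour := by
  intro hD hM hS X _ _ _ _ _ _ e hemb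
  obtain ⟨M, _, _, _, _, _, ⟨eM⟩, hcs⟩ := hD X e hemb
  haveI : CompactSpace M :=
    Literature.Topology.FourManifolds.compactSpace_of_homotopyEquiv_sphere_four_holds M eM
  haveI : SimplyConnectedSpace 𝕊⁴ :=
    Literature.Topology.FourManifolds.simplyConnectedSpace_sphere_four_holds
  haveI : SimplyConnectedSpace M := eM.simplyConnectedSpace
  obtain ⟨f, hf, h6⟩ := hM M eM
  have hfin : (criticalSet (𝓡 4) f).Finite := Set.finite_of_encard_le_coe h6
  obtain ⟨g, ⟨hg, hconn, hnd⟩, hcount⟩ := hS M f hf hfin X hcs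
  refine ⟨g, hg, hconn, hnd, ?_⟩
  have h2 : (2 : ℕ∞) ≠ ⊤ := by decide
  have h : (circleCriticalSet g).encard + 2 ≤ 4 + 2 :=
    hcount.trans (h6.trans (by norm_num))
  exact (ENat.add_le_add_iff_right h2).1 h

/-- WIRING CHECK: the three sorried stubs compose to a closed term of the crux's type (modulo
their `sorry`s). Deliberately an `example` (no constant enters the environment), so that a BC3
probe importing this file cannot close `stub → WidthFour` by `exact?` through a pre-composed
witness. -/
example : WidthFour :=
  WidthFour_of stub_desum stub_morseSix stub_stabilise

end Summit.SmoothPoincare4.SmoothPoincare4.Cruxes.WidthFour.Birth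

end
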